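import Summits.ResolutionOfSingularities.ResolutionOfSingularities.Theorems.FrobeniusClosingPatchingRelPerfectSliceOfEngine
import Literature.AlgebraicGeometry.Resolution.ProjectiveModelsDomination
import Literature.AlgebraicGeometry.Resolution.ProjectiveBirationalBlowupProofs
import HarnessLib

/-!
# Crux `PatchingRelPerfect` (stmt-ResolutionOfSingularities-16161), chain w52, task W4′:
# the regular ROOF is a BLOWING UP (projective iterated join + Liu 8.1.24 for models)

[OURS · L1 W5.2 · W4′] For the planner's blow-up form P0 of the open core (CHAIN.md v0.1 §3), the
slice must hand the roof engine, at every closed point `m` of the dominating model `N`, a regular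
roof `q : N → N'` which IS A BLOWING UP along a non-zero ideal sheaf.  The line's engine
(`PatchingRelPerfect.SliceOfEngine`, landed p170125) builds `N` as the iterated join of PROPER
models and the roof as a domination `N → M_T` of a member of the resolving system; both steps are
re-run here with PROJECTIVE models, and Liu's Thm. 8.1.24 for models of a function field
(tree theorem `ProperModel.Hom.exists_isBlowup_of_isProjectiveOver`, sorry-free) makes the
domination a blowing up:

* `exists_projHom_forall_nonempty_hom` — W4′a (typed target `ChainW52.W4a_ExistsProjJoin`): a
  projective model `M₀` and a finite list of projective models of `K/k` are dominated by ONE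
  projective model (induction with `ProjModel.join` / `joinFst` / `joinSnd`);
* `exists_roof_isBlowup` — W4′b (typed target `ChainW52.W4b_ExistsRoofIsBlowup`, verbatim
  unfolded): for a projective model `N` of `K/k`, `trdeg_k K = 4`, dominating every member of a
  finite list of projective models on some member of which every valuation ring of `K/k` is
  regularly centred, every point `m ∈ N` has a regular roof `q : N.X → N'` (separated, finite
  type, integral, `dim ≤ 4`, proper, birational, regular at `q m`) together with a non-zero ideal
  sheaf `I` on `N'` with `IsBlowup q I`.

Citation-level; nothing is assumed. Nothing here is a statement of the manuscript under review.

## References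

* O. Piltant, RACSAM 107 (2013), Prop. 5.1 (proof, Step 2) and Cor. 5.7. [Piltant2013]
* O. Zariski, P. Samuel, *Commutative Algebra* II, Ch. VI §17 (joins, domination). [ZariskiSamuel1960]
* Q. Liu, *Algebraic Geometry and Arithmetic Curves* (2002), Thm. 8.1.24. [Liu2002]
-/

-- `Summit.<Summit>.<Sub>.Theorems` with `Sub = Summit` (single-conjunct summit, D-0017)
set_option linter.dupNamespace false

noncomputable section

open CategoryTheory CategoryTheory.Limits AlgebraicGeometry Literature.AlgebraicGeometry.Resolution
open Literature.AlgebraicGeometry (Motives.IsProjectiveOver)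
open TopologicalSpace IsLocalRing

namespace Summit.ResolutionOfSingularities.ResolutionOfSingularities.Theorems

namespace PatchingRelPerfect.SliceOfEngine

variable {k K : Type} [Field k] [Field K] [Algebra k K]

/-- **W4′a — the iterated join of PROJECTIVE models**: a projective model `M₀` and a finite list
of projective models of `K/k` are all dominated by ONE projective model (induction on the list
with the projective join `ProjModel.join`, `joinFst`, `joinSnd` — the closure of the diagonal
`K`-point in the product, projective over `k`). [cite: Piltant2013, Prop. 5.1 (proof, Step 2)]
[cite: ZariskiSamuel1960, Ch. VI §17] -/
theorem exists_projHom_forall_nonempty_hom (M₀ : ProjModel k K) :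
    ∀ l : List (ProjModel k K), ∃ (N : ProjModel k K) (_ : N.Hom M₀),
      ∀ M ∈ l, Nonempty (N.Hom M)
  | [] => ⟨M₀, ProperModel.Hom.id M₀.toProperModel, fun M hM => by simp at hM⟩
  | M :: l => by
    obtain ⟨N, φ, hN⟩ := exists_projHom_forall_nonempty_hom M₀ l
    refine ⟨ProjModel.join N M, (ProjModel.joinFst N M).comp φ, fun M' hM' => ?_⟩
    rcases List.mem_cons.mp hM' with h | hl
    · subst h
      exact ⟨ProjModel.joinSnd N M'⟩
    · obtain ⟨ψ⟩ := hN M' hl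
      exact ⟨(ProjModel.joinFst N M).comp ψ⟩

/-- **W4′b — pointwise regular roofs WHICH ARE BLOWING UPS.** If the projective model `N` of
`K/k`, `trdeg_k K = 4`, dominates every member of a finite list of projective models on SOME
member of which every valuation ring of `K/k` has a regular centre, then every point `m ∈ N` has
a regular roof which is a blowing up: `m` is the centre of a valuation ring `v`
(`KModel.exists_isCentre_of_isGenericPoint`), regularly centred on some member `M`; the
domination `q : N → M` is proper and birational, maps `m` to the centre of `v` on `M`
(`Hom.map_centre`), `dim M = trdeg_k K = 4`, and — both models being projective over `k` — `q`
is the blowing up of `M` along a non-zero ideal sheaf (Liu 2002, Thm. 8.1.24 for models: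
`ProperModel.Hom.exists_isBlowup_of_isProjectiveOver`). Verbatim the typed target
`ChainW52.W4b_ExistsRoofIsBlowup`. [cite: Piltant2013, Prop. 5.1 and Cor. 5.7]
[cite: Liu2002, Thm. 8.1.24] -/
theorem exists_roof_isBlowup (N : ProjModel k K) (hK : Algebra.trdeg k K = ((4 : ℕ) : Cardinal))
    (l : List (ProjModel k K)) (hhom : ∀ M ∈ l, Nonempty (N.Hom M))
    (hcov : ∀ v : ZariskiRiemannSpace k K, ∃ M ∈ l, M.toProperModel.RegCentre v) (m : N.X) :
    ∃ (N' : Scheme.{0}) (gN : N' ⟶ Spec (.of k)) (q : N.X ⟶ N') (I : N'.IdealSheafData),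
      IsSeparated gN ∧ LocallyOfFiniteType gN ∧ QuasiCompact gN ∧ IsIntegral N' ∧
      q ≫ gN = N.π ∧ IsProper q ∧ IsBirational q ∧ topologicalKrullDim N' ≤ 4 ∧
      IsRegularLocalRing (N'.presheaf.stalk (q.base m)) ∧ I ≠ ⊥ ∧ IsBlowup q I := by
  -- `m` is the centre of some valuation ring `v` of `K/k`
  have hgen : IsGenericPoint N.toKModel.genericPt (Set.univ : Set N.X) := by
    rw [N.genericPt_eq']
    exact genericPoint_spec N.X
  obtain ⟨v, hv⟩ := N.toKModel.exists_isCentre_of_isGenericPoint hgen m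
  -- `v` has a regular centre on some member `M`, dominated by `N`
  obtain ⟨M, hMl, hMv⟩ := hcov v
  rw [M.toProperModel_regCentre_iff] at hMv
  obtain ⟨φ⟩ := hhom M hMl
  have hm : φ.f.base m = M.centre v := by
    rw [ProjModel.eq_centre_of_isCentre hv]
    exact φ.map_centre v
  have hdimM : topologicalKrullDim M.X ≤ 4 := by
    have h := Pialt.OpenRange.properModel_topologicalKrullDim_eq_of_trdeg M.toProperModel hK
    change topologicalKrullDim M.X = _ at h
    rw [h]
    exact le_of_eq (by rfl)
  -- the domination of projective models is a blowing up along a non-zero ideal sheaf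
  obtain ⟨I, hI, hblow⟩ := ProperModel.Hom.exists_isBlowup_of_isProjectiveOver φ.toProperModel
    N.isProjectiveOver M.isProjectiveOver
  refine ⟨M.X, M.π, φ.f, I, inferInstance, inferInstance, inferInstance, inferInstance, φ.f_π,
    inferInstance, φ.isBirational, hdimM, ?_, hI, hblow⟩
  rw [hm]
  exact hMv

end PatchingRelPerfect.SliceOfEngine

open PatchingRelPerfect.SliceOfEngine in
/-- **W4′a in the typed target's closed form** (`ChainW52.W4a_ExistsProjJoin`, all arguments
explicit). [cite: Piltant2013, Prop. 5.1 (proof, Step 2)] -/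
theorem w4a_existsProjJoin :
    ∀ (k K : Type) [Field k] [Field K] [Algebra k K] (M₀ : ProjModel k K)
      (l : List (ProjModel k K)),
      ∃ (N : ProjModel k K) (_ : N.Hom M₀), ∀ M ∈ l, Nonempty (N.Hom M) :=
  fun _ _ _ _ _ M₀ l => exists_projHom_forall_nonempty_hom M₀ l

open PatchingRelPerfect.SliceOfEngine in
/-- **W4′b in the typed target's closed form** (`ChainW52.W4b_ExistsRoofIsBlowup`, all arguments
explicit). [cite: Piltant2013, Prop. 5.1 and Cor. 5.7] [cite: Liu2002, Thm. 8.1.24] -/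
theorem w4b_existsRoofIsBlowup :
    ∀ (k K : Type) [Field k] [Field K] [Algebra k K] (N : ProjModel k K),
      Algebra.trdeg k K = ((4 : ℕ) : Cardinal) →
      ∀ (l : List (ProjModel k K)), (∀ M ∈ l, Nonempty (N.Hom M)) →
        (∀ v : ZariskiRiemannSpace k K, ∃ M ∈ l, M.toProperModel.RegCentre v) → ∀ m : N.X,
        ∃ (N' : Scheme.{0}) (gN : N' ⟶ Spec (.of k)) (q : N.X ⟶ N') (I : N'.IdealSheafData),
          IsSeparated gN ∧ LocallyOfFiniteType gN ∧ QuasiCompact gN ∧ IsIntegral N' ∧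
          q ≫ gN = N.π ∧ IsProper q ∧ IsBirational q ∧ topologicalKrullDim N' ≤ 4 ∧
          IsRegularLocalRing (N'.presheaf.stalk (q.base m)) ∧ I ≠ ⊥ ∧ IsBlowup q I :=
  fun _ _ _ _ _ N hK l hhom hcov m => exists_roof_isBlowup N hK l hhom hcov m

end Summit.ResolutionOfSingularities.ResolutionOfSingularities.Theorems

end
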